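import Summits.PneNP.PneNP.Theses.CnfIdealGenLength
import Summits.PneNP.PneNP.Theorems.CnfIdealGenLengthRankDefectRepresentationsTheoryToCnf
import Summits.PneNP.PneNP.Theorems.CnfIdealGenLengthRankDefectRepresentationsDiagonal
import Summits.PneNP.PneNP.Theorems.CnfIdealGenLengthRankDefectRepresentationsLinearPhantoms
import Summits.PneNP.PneNP.Theorems.CnfIdealGenLengthRankDefectRepresentationsQuadraticWitness
import Summits.PneNP.PneNP.Theorems.CnfIdealGenLengthRankDefectRepresentationsPairStability

/-!
# Crux `RankDefectRepresentations` (stmt-PneNP-18923, route CnfIdealGenLength) — line `phantom-kernel`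

The crux (RDR): a polynomial-size unsatisfiable CNF family `φ_n` and, for every exponent `c` and all large
`n`, almost-representations `M` of the Boolean cube in characteristic `0` (every Boolean axiom `x_i² - x_i`
and commutator axiom `[x_i, x_j]` of rank `≤ t` at `M`) with `rank P_φ(M) > n^c · t`.

THE LINE (crux-plan for idea card `Ideas/phantom-kernel.md`, after TRIAGE-r1-1 and TRIAGE-r1-2). The PHANTOM KERNEL
`U = ⋂_{κ ∈ φ} ker Q_κ(M)` satisfies `P_φ(M) u = u` for `u ∈ U` (peel the factors `1 - Q_κ` right to left;
no commutation, no clause order), hence `dim U ≤ rank P_φ(M)` for EVERY tuple (`finrank_phantomKernel_le_rank`,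
PROVED). Read in reverse, a pair `(M, U)` VALIDATES the clauses whose words kill `U`; if the validated
clauses of length `≤ w` are jointly unsatisfiable ("contradictory phantom theory"), they ARE a polynomial-size
unsatisfiable CNF with `U` inside its phantom kernel. So the open content of RDR along this line is ONE
CNF-free statement about matrices and a subspace:

* `stub_contradictoryPhantoms` (S1, HARD = the line): `∃ w ∀ c ∀ᶠ n`: some `M : Fin n → K^{d×d}` (char 0,
  axiom defects of rank `≤ t`) and `U ≤ K^d` with `dim U > n^c · t` whose width-`w` phantom theory is
  contradictory. Rungs known (all of LINEAR ratio `dim U / t`, all Frege-easy as the in-tree Frege ceiling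
  `dim U ≤ rank P_φ ≤ K s³ t` demands): selector ∘ Mermin–Peres (`t = 4`, ratio `n/10`), selector ∘ Cabello's
  18-ray Kochen–Specker set (`t = 2`, ratio `2n/19`), selector ∘ small random 3-CNF gadgets (`d = 2`, `t = 1`,
  found by the line's falsifier run — the phantom mechanism is not parity-bound). First informative target:
  ANY family with superlinear ratio (R1); the gadget law `dim U ≤ (n² + n) · t · max_b (u_b / t_b)` for
  block-diagonal models says the blocks themselves must improve. Any proof of S1 is a superpolynomial Frege
  lower bound: P ≠ NP is NOT moved by this file; F-N2 is a FRONTIER formal rung.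
* `stub_theoryToCnf` (S2, tool, true): contradictory width-`w` theory ↦ explicit unsatisfiable CNF with
  `≤ (2n+2)^(w+1)` clauses, size `≤ (w+1)(2n+2)^(w+1)`, `U ≤` its phantom kernel (finite enumeration).
* `stub_diagonal` (S3, tool, true): per-exponent witnesses with a size bound uniform in the exponent ↦ one
  formula family for all exponents (diagonal choice `c(n) → ∞`).
* `stub_quadraticWitness` (N1, calibration of the crux, true; lead): the refuter's block witness for all `n` —
  axiom ranks `≤ 2`, `rank P_φ ≥ n(n-1)/2` for `φ = {x_i}_i ∪ {¬x_0 ∨ … ∨ ¬x_{n-1}}`.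
* `stub_pairStability` (N2, first rung of the kill path, true; lead): two idempotents are within rank
  `10 · rank[E,F]` of a commuting idempotent pair (ST at `n = 2`, linear modulus).
* `stub_linearPhantoms` (R0, calibration rung, true; added by the lead prover at registration): the inner
  predicate of S1 at LINEAR ratio, uniformly in `n` (selector ∘ 3-variable 2×2 gadget over `ℚ`, `t = 1`,
  `dim U = ⌊n/5⌋`, width `3`) — not consumed by the composition; it is the first rung R0 → R1 → S1.
* PROVED here: the peeling lemma, `pnc_of_specs : S1 → S2 → S3 → PNC`, and the skeleton theorem
  `RankDefectRepresentations_of` (PNC → RDR inlined) concluding the crux BY NAME; `sorry` only in the stubs.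

Line card: `Lines/phantom-kernel.md` (mechanism, stubs, triage answers, falsifier run, barriers, dead lines).
References: Li–Tzameret–Wang arXiv:1412.8746 (ncIPS = Frege); Atserias–Kolaitis–Severini, JCSS 2019
(doi:10.1016/j.jcss.2019.05.003; operator assignments, Thm 3); Cleve–Mittal arXiv:1209.2729; Mermin, Rev. Mod.
Phys. 65 (1993); Cabello–Estebaranz–García-Alcaine, Phys. Lett. A 212 (1996) (arXiv:quant-ph/9706009);
Elek–Grabowski arXiv:1708.05338 (Thm 1); arXiv:2401.04676 (Thm 5.1); Becker–Mosheiff arXiv:1811.00578.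
-/

set_option linter.dupNamespace false -- `Summit.PneNP.PneNP.…` is the layout-mandated namespace

namespace Summit.PneNP.PneNP.Cruxes.RankDefectRepresentations.PhantomKernel

open Filter
open Literature.Computability.Complexity
open Literature.Computability.MetaComplexity
open Literature.Computability.MetaComplexity.NCIPS
open Summit.PneNP.PneNP.Theses.CnfIdealGenLength

/-! ### Vocabulary (local abbreviations; every stub below is ALSO spelled out in library vocabulary) -/

/-- Evaluation of a non-commutative polynomial at a matrix tuple `M` (the map used in the crux). -/
noncomputable abbrev ev {K : Type} [Field K] {n d : ℕ} (M : Fin n → Matrix (Fin d) (Fin d) K)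
    (g : MonoidAlgebra K (FreeMonoid (Fin n))) : Matrix (Fin d) (Fin d) K :=
  MonoidAlgebra.lift K (Matrix (Fin d) (Fin d) K) (FreeMonoid (Fin n)) (FreeMonoid.lift M) g

/-- `M` is an almost-representation of the Boolean cube: every Boolean axiom `x_i² - x_i` and every
commutator axiom `x_i x_j - x_j x_i` evaluates to a matrix of rank `≤ t`. -/
def AlmostRep {K : Type} [Field K] {n d : ℕ} (M : Fin n → Matrix (Fin d) (Fin d) K) (t : ℕ) : Prop :=
  ∀ g : MonoidAlgebra K (FreeMonoid (Fin n)), IsAxiom g → (ev M g).rank ≤ t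

/-- The phantom kernel of `φ` at `M`: the common kernel of all clause words `Q_κ(M)`, `κ ∈ φ`
(independent of the clause order; depends on the literal order inside each clause). -/
noncomputable def phantomKernel {K : Type} [Field K] {n d : ℕ} (M : Fin n → Matrix (Fin d) (Fin d) K)
    (φ : CNF (Fin n)) : Submodule K (Fin d → K) :=
  ⨅ κ ∈ φ, LinearMap.ker (Matrix.toLin' (ev M (clauseWord K κ)))

/-- The clause `κ` is VALIDATED by the pair `(M, U)`: its clause word kills `U`. -/
def Validated {K : Type} [Field K] {n d : ℕ} (M : Fin n → Matrix (Fin d) (Fin d) K)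
    (U : Submodule K (Fin d → K)) (κ : Clause (Fin n)) : Prop :=
  ∀ u ∈ U, (ev M (clauseWord K κ)).mulVec u = 0

/-- The width-`w` PHANTOM THEORY of `(M, U)` — all clauses of length `≤ w` validated on `U` — is
CONTRADICTORY: every Boolean assignment falsifies one of them. -/
def Contradictory {K : Type} [Field K] {n d : ℕ} (w : ℕ) (M : Fin n → Matrix (Fin d) (Fin d) K)
    (U : Submodule K (Fin d → K)) : Prop :=
  ∀ σ : Fin n → Bool, ∃ κ : Clause (Fin n), κ.length ≤ w ∧ Validated M U κ ∧ Clause.eval σ κ = false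

/-- PNC — phantom null-space representations (the idea card's transfer target `C⁺`): the crux with
`rank P_φ(M)` replaced by the dimension of the phantom kernel. `PNC → RDR` is proved below. -/
def PhantomKernelRepresentations : Prop :=
  ∃ p : Polynomial ℕ, ∃ φ : (n : ℕ) → CNF (Fin n),
    (∀ n, ¬ (φ n).Satisfiable ∧ CNF.numClauses (φ n) ≤ p.eval n ∧ CNF.size (φ n) ≤ p.eval n) ∧
    ∀ c : ℕ, ∀ᶠ n : ℕ in atTop, ∃ (K : Type) (_ : Field K) (_ : CharZero K) (d t : ℕ)
      (M : Fin n → Matrix (Fin d) (Fin d) K),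
      AlmostRep M t ∧ n ^ c * t < Module.finrank K (phantomKernel M (φ n))

/-! ### The interface: the three specs the composition consumes -/

/-- S1 (the HARD stub, = the whole open content of the line): CONTRADICTORY PHANTOMS. For every
exponent `c`, for all large `n`, some almost-representation `M` of the `n`-cube over a field of
characteristic `0` with axiom defects of rank `≤ t` carries a subspace `U` of dimension `> n^c · t` whose
width-`w` phantom theory is contradictory (`w` uniform in `c` and `n`). CNF-free and per-`(c, n)`:
the unsatisfiable formula is READ OFF the partial model, not chosen in advance. -/
def ContradictoryPhantomsSpec : Prop :=
  ∃ w : ℕ, ∀ c : ℕ, ∀ᶠ n : ℕ in atTop, ∃ (K : Type) (_ : Field K) (_ : CharZero K) (d t : ℕ)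
    (M : Fin n → Matrix (Fin d) (Fin d) K) (U : Submodule K (Fin d → K)),
    AlmostRep M t ∧ n ^ c * t < Module.finrank K U ∧ Contradictory w M U

/-- S2 (tool, true): THEORY-TO-CNF. A contradictory width-`w` phantom theory contains an explicit
unsatisfiable CNF of at most `(2n+2)^(w+1)` clauses and size `≤ (w+1)(2n+2)^(w+1)` whose phantom kernel
contains `U` (enumerate the short clauses, keep the validated ones; deduplicate). -/
def TheoryToCnfSpec : Prop :=
  ∀ (n w : ℕ) (K : Type) [Field K] (d : ℕ) (M : Fin n → Matrix (Fin d) (Fin d) K)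
    (U : Submodule K (Fin d → K)), Contradictory w M U →
    ∃ φ : CNF (Fin n), ¬ φ.Satisfiable ∧ CNF.numClauses φ ≤ (2 * n + 2) ^ (w + 1) ∧
      CNF.size φ ≤ (w + 1) * (2 * n + 2) ^ (w + 1) ∧ U ≤ phantomKernel M φ

/-- S3 (tool, true): DIAGONAL. If for every exponent `c` there are, for all large `n`, SOME small
unsatisfiable CNF on `n` variables (size bound `p` UNIFORM in `c`) and an almost-representation whose
phantom kernel beats `n^c · t`, then one family `φ` (chosen diagonally, `c(n) → ∞`) works for every `c`:
the `∀ c ∃ φ → ∃ φ ∀ c` swap under a uniform size bound. -/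
def DiagonalSpec : Prop :=
  ∀ p : Polynomial ℕ,
    (∀ c : ℕ, ∀ᶠ n : ℕ in atTop, ∃ φ : CNF (Fin n),
      (¬ φ.Satisfiable ∧ CNF.numClauses φ ≤ p.eval n ∧ CNF.size φ ≤ p.eval n) ∧
      ∃ (K : Type) (_ : Field K) (_ : CharZero K) (d t : ℕ) (M : Fin n → Matrix (Fin d) (Fin d) K),
        AlmostRep M t ∧ n ^ c * t < Module.finrank K (phantomKernel M φ)) →
    PhantomKernelRepresentations

/-! ### Registered stubs (library vocabulary only; `sorry` nowhere else in this file) -/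

/-- STUB S1 (hard; = `ContradictoryPhantomsSpec` unfolded) — the ONLY open stub of the line after 2026-08-27T23:00Z (lead's verdict: crux-sized both ways, see `Lines/phantom-kernel-S1-analysis.md`; unconditional `S1 ⇒ RDR` is `Theorems/…PhantomClosure.lean` p580392, kill path `ST-poly ⇒ ¬S1` ibid.). Contradictory phantoms: almost-representations
of the `n`-cube in characteristic `0` with axiom-defect rank `≤ t` and a subspace of dimension `> n^c t`
on which a contradictory set of clause words of length `≤ w` vanishes. Why plausibly true: it is the
representation-theoretic form of "some polynomial-size CNF family is hard for (non-commutative-IPS /)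
Frege" read through partial non-commutative models; first rung (ratio `n/10`, `t = 4`, `w = 3`):
selector ∘ Mermin–Peres (TRIAGE-r1-1.md). Why it might fail: every construction must be Frege-hard
(in-tree ceiling `dim U ≤ rank P_φ ≤ K s³ t` for Frege-easy phantom theories), and no finite-dimensional
partial model with `dim U > n² t` is known. Size XL (open). -/
theorem stub_contradictoryPhantoms :
    ∃ w : ℕ, ∀ c : ℕ, ∀ᶠ n : ℕ in atTop, ∃ (K : Type) (_ : Field K) (_ : CharZero K) (d t : ℕ)
      (M : Fin n → Matrix (Fin d) (Fin d) K) (U : Submodule K (Fin d → K)),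
      (∀ g : MonoidAlgebra K (FreeMonoid (Fin n)), IsAxiom g →
        (MonoidAlgebra.lift K (Matrix (Fin d) (Fin d) K) (FreeMonoid (Fin n)) (FreeMonoid.lift M) g).rank
          ≤ t) ∧
      n ^ c * t < Module.finrank K U ∧
      ∀ σ : Fin n → Bool, ∃ κ : Clause (Fin n), κ.length ≤ w ∧
        (∀ u ∈ U, (MonoidAlgebra.lift K (Matrix (Fin d) (Fin d) K) (FreeMonoid (Fin n))
          (FreeMonoid.lift M) (clauseWord K κ)).mulVec u = 0) ∧
        Clause.eval σ κ = false := by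
  sorry

/-- STUB S2 (tool; = `TheoryToCnfSpec` unfolded) — LANDED p579667 (`Theorems/CnfIdealGenLengthRankDefectRepresentationsTheoryToCnf.lean`, lead). From a contradictory width-`w` phantom theory to an
explicit unsatisfiable CNF with `≤ (2n+2)^(w+1)` clauses, size `≤ (w+1)(2n+2)^(w+1)`, all of whose clause
words kill `U`. Why true: the clauses of length `≤ w` over `Fin n` number `≤ (2n+1)^w`; keep the validated
ones (or the finitely many `κ_σ`); unsatisfiable because every `σ` falsifies one of them. Size M
(finite enumeration / `Finset.image` bookkeeping). -/
theorem stub_theoryToCnf :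
    ∀ (n w : ℕ) (K : Type) [Field K] (d : ℕ) (M : Fin n → Matrix (Fin d) (Fin d) K)
      (U : Submodule K (Fin d → K)),
      (∀ σ : Fin n → Bool, ∃ κ : Clause (Fin n), κ.length ≤ w ∧
        (∀ u ∈ U, (MonoidAlgebra.lift K (Matrix (Fin d) (Fin d) K) (FreeMonoid (Fin n))
          (FreeMonoid.lift M) (clauseWord K κ)).mulVec u = 0) ∧
        Clause.eval σ κ = false) →
      ∃ φ : CNF (Fin n), ¬ φ.Satisfiable ∧ CNF.numClauses φ ≤ (2 * n + 2) ^ (w + 1) ∧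
        CNF.size φ ≤ (w + 1) * (2 * n + 2) ^ (w + 1) ∧
        U ≤ ⨅ κ ∈ φ, LinearMap.ker (Matrix.toLin'
          (MonoidAlgebra.lift K (Matrix (Fin d) (Fin d) K) (FreeMonoid (Fin n)) (FreeMonoid.lift M)
            (clauseWord K κ))) := by
  exact Summit.PneNP.PneNP.Theorems.CnfIdealGenLengthRankDefectRepresentationsTheoryToCnf.stub_theoryToCnf

/-- STUB S3 (tool; = `DiagonalSpec` unfolded) — LANDED p579615 (`Theorems/CnfIdealGenLengthRankDefectRepresentationsDiagonal.lean`, lead). Diagonal choice: per-exponent witnesses with a size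
bound uniform in the exponent give one formula family good for every exponent (`φ n := φ_{c(n), n}` with
`c(n) → ∞` chosen so that all witnesses up to exponent `c(n)` exist at `n`; pad with the one-clause
contradiction `[[]]` and the polynomial `p + 1` below the first threshold). Why true: elementary
(`Filter.eventually_atTop` + `Nat.find`). Size M. -/
theorem stub_diagonal :
    ∀ p : Polynomial ℕ,
      (∀ c : ℕ, ∀ᶠ n : ℕ in atTop, ∃ φ : CNF (Fin n),
        (¬ φ.Satisfiable ∧ CNF.numClauses φ ≤ p.eval n ∧ CNF.size φ ≤ p.eval n) ∧
        ∃ (K : Type) (_ : Field K) (_ : CharZero K) (d t : ℕ) (M : Fin n → Matrix (Fin d) (Fin d) K),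
          (∀ g : MonoidAlgebra K (FreeMonoid (Fin n)), IsAxiom g →
            (MonoidAlgebra.lift K (Matrix (Fin d) (Fin d) K) (FreeMonoid (Fin n)) (FreeMonoid.lift M)
              g).rank ≤ t) ∧
          n ^ c * t < Module.finrank K (⨅ κ ∈ φ, LinearMap.ker (Matrix.toLin'
            (MonoidAlgebra.lift K (Matrix (Fin d) (Fin d) K) (FreeMonoid (Fin n)) (FreeMonoid.lift M)
              (clauseWord K κ))) : Submodule K (Fin d → K))) →
      ∃ p' : Polynomial ℕ, ∃ φ : (n : ℕ) → CNF (Fin n),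
        (∀ n, ¬ (φ n).Satisfiable ∧ CNF.numClauses (φ n) ≤ p'.eval n ∧ CNF.size (φ n) ≤ p'.eval n) ∧
        ∀ c : ℕ, ∀ᶠ n : ℕ in atTop, ∃ (K : Type) (_ : Field K) (_ : CharZero K) (d t : ℕ)
          (M : Fin n → Matrix (Fin d) (Fin d) K),
          (∀ g : MonoidAlgebra K (FreeMonoid (Fin n)), IsAxiom g →
            (MonoidAlgebra.lift K (Matrix (Fin d) (Fin d) K) (FreeMonoid (Fin n)) (FreeMonoid.lift M)
              g).rank ≤ t) ∧
          n ^ c * t < Module.finrank K (⨅ κ ∈ φ n, LinearMap.ker (Matrix.toLin'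
            (MonoidAlgebra.lift K (Matrix (Fin d) (Fin d) K) (FreeMonoid (Fin n)) (FreeMonoid.lift M)
              (clauseWord K κ))) : Submodule K (Fin d → K)) := by
  exact Summit.PneNP.PneNP.Theorems.CnfIdealGenLengthRankDefectRepresentationsDiagonal.stub_diagonal

/-- STUB R0 (calibration rung) — LANDED p581498 (`Theorems/CnfIdealGenLengthRankDefectRepresentationsLinearPhantoms.lean`, lead). LINEAR PHANTOMS:
for EVERY `n` there is an almost-representation of the `n`-cube over a field of characteristic `0` with axiom defects
of rank `≤ t ≤ C` and a subspace `U` with `n ≤ C · (dim U + 1)` whose width-`w` phantom theory is contradictory —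
the inner predicate of S1 at linear ratio `dim U / t ≥ n / C²`, uniformly in `n`. Why true (lead's construction,
verified in exact arithmetic for `N ≤ 3`, `compute/r0_check.py`): `K = ℚ`, `N = ⌊n/5⌋` blocks `ℚ²` (coordinates
`(b,0), (b,1)`), `d = 2N`, `U = span {e_(b,0)}` (`dim U = N`), `t = 1`, `w = 3`, `C = 5`. Variable `5b + r` acts by:
`r = 0`: `y_b` = projection onto block `b`; `r = 1`: `z_b` = projection onto blocks `≤ b`; `r = 2,3,4`: on block `b`
the idempotents `G₀ = diag(0,1)`, `G₁ = [[0,1],[0,1]]`, `G₂ = [[1,0],[1,0]]` (zero on other blocks); variables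
`≥ 5N` act by `0`. All are exact idempotents; the only non-zero commutators are the three inside a block, of rank `1`.
Validated clauses (written literal order; positive literal `↦ 1 - E`, negative `↦ E`): `[z_{N-1}]`,
`[¬z_b, z_{b-1}, y_b]` (`b ≥ 1`), `[¬z_0, y_0]`, and per block `[¬y_b, ¬x0_b]`, `[¬y_b, ¬x1_b]`, `[¬y_b, x0_b, x2_b]`,
`[¬y_b, x1_b, ¬x2_b]` (the last two clause words are `0` as matrices: `(1-G₀)(1-G₂) = 0 = (1-G₁)G₂`; `G₀ e₁ = G₁ e₁ = 0`).
Contradiction: `z_{N-1}` true ⇒ least `b` with `z_b` true has `y_b` true ⇒ `x0_b, x1_b` false ⇒ `x2_b` both true and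
false. For `n ≤ 4`: `d = 0`, `U = ⊤ = 0`, the empty clause. First rung of R0 (linear, here) → R1 (superlinear,
open) → S1 (superpolynomial). -/
theorem stub_linearPhantoms :
    ∃ w C : ℕ, ∀ n : ℕ, ∃ (K : Type) (_ : Field K) (_ : CharZero K) (d t : ℕ)
      (M : Fin n → Matrix (Fin d) (Fin d) K) (U : Submodule K (Fin d → K)),
      (∀ g : MonoidAlgebra K (FreeMonoid (Fin n)), IsAxiom g →
        (MonoidAlgebra.lift K (Matrix (Fin d) (Fin d) K) (FreeMonoid (Fin n)) (FreeMonoid.lift M) g).rank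
          ≤ t) ∧
      t ≤ C ∧ n ≤ C * (Module.finrank K U + 1) ∧
      ∀ σ : Fin n → Bool, ∃ κ : Clause (Fin n), κ.length ≤ w ∧
        (∀ u ∈ U, (MonoidAlgebra.lift K (Matrix (Fin d) (Fin d) K) (FreeMonoid (Fin n))
          (FreeMonoid.lift M) (clauseWord K κ)).mulVec u = 0) ∧
        Clause.eval σ κ = false := by
  exact Summit.PneNP.PneNP.Theorems.CnfIdealGenLengthRankDefectRepresentationsLinearPhantoms.stub_linearPhantoms

/-- STUB N1 (calibration of the CRUX itself) — LANDED p581240 (`Theorems/CnfIdealGenLengthRankDefectRepresentationsQuadraticWitness.lean`, lead). QUADRATIC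
CLAUSE-PRODUCT WITNESS: for EVERY `n` the crux's inner predicate holds at quadratic ratio — an almost-representation
over `ℚ` with axiom ranks `≤ t ≤ C` under which the clause product of the unsatisfiable CNF
`{x_0}, …, {x_{n-1}}, {¬x_0 ∨ … ∨ ¬x_{n-1}}` (size `2n`) has rank `≥ n²/C - n` (the refuter vet's block witness,
15:46Z note on the item, checked there by exact arithmetic for `n ≤ 6` only). Why true: blocks `ℚ²` indexed by the
pairs `i < j` (`d = n(n-1)`); on block `{i,j}`: `E_i = diag(1,0)`, `E_j = ½[[1,1],[1,1]]`, `E_k = 1` (`k ∉ {i,j}`);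
all exact idempotents, the only non-zero commutator on a block is `[E_i, E_j] = ½[[0,1],[-1,0]]` so `t = 2`; the
clause product is `W - W²` with `W = E_0 ⋯ E_{n-1}`, blockwise `pq - (pq)² = ¼[[1,1],[0,0]]` of rank `1`, total rank
`n(n-1)/2` (`rank_blockDiagonal`); transport by `lift_reindex` / `lift_blockDiagonal` (BlockLaw file, p578807) and
`lift_clauseProduct` (RankCount). Consequence: `RankDefectRepresentations` restricted to exponents `c < 2` holds;
the crux is the passage from `n²` to `n^{ω(1)}`. -/
theorem stub_quadraticWitness :
    ∃ C : ℕ, ∀ n : ℕ, ∃ (K : Type) (_ : Field K) (_ : CharZero K) (d t : ℕ)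
      (M : Fin n → Matrix (Fin d) (Fin d) K),
      (∀ g : MonoidAlgebra K (FreeMonoid (Fin n)), IsAxiom g →
        (MonoidAlgebra.lift K (Matrix (Fin d) (Fin d) K) (FreeMonoid (Fin n)) (FreeMonoid.lift M) g).rank
          ≤ t) ∧
      t ≤ C ∧
      n * n ≤ C * ((MonoidAlgebra.lift K (Matrix (Fin d) (Fin d) K) (FreeMonoid (Fin n)) (FreeMonoid.lift M)
        (clauseProduct K (((List.finRange n).map fun i => [(i, true)]) ++
          [(List.finRange n).map fun i => (i, false)]))).rank + n) := by
  exact Summit.PneNP.PneNP.Theorems.CnfIdealGenLengthRankDefectRepresentationsQuadraticWitness.stub_quadraticWitness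

/-- STUB N2 (first rung of the KILL PATH) — LANDED p581825 (`Theorems/CnfIdealGenLengthRankDefectRepresentationsPairStability.lean`, lead; constant 4). PAIR STABILITY
with LINEAR modulus: two idempotent matrices are within total rank `C · rank [E, F]` of a COMMUTING idempotent pair
— the `n = 2`, exact-idempotent case of the conclusion of the ST-poly hypothesis `hST` of
`not_rankDefectRepresentations_of_polyStable` / `not_contradictoryPhantoms_of_polyStable` (the general case, with
a polynomial modulus in `n`, refutes the crux and S1; known modulus `2^{O(n)} · t`, arXiv:2401.04676 Thm 5.1).
Why true (TRIAGE-r1-2 evidence E1, hand proof; constant `C = 10` works): keep `E' = E`; compress `F` to the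
commutant of `E`, `F_c = EFE + (1-E)F(1-E)`, `F - F_c = E[E,F] + [F,E]E` has rank `≤ 2 rank[E,F]`;
`F_c² - F_c` has rank `≤ 8 rank[E,F]`; the projection `F'` onto `ker (F_c - 1)^d` along `range (F_c - 1)^d`
(Fitting decomposition, `LinearMap.isCompl_iSup_ker_pow_iInf_range_pow`; both summands are `E`-invariant) is an
idempotent commuting with `E` with `rank (F_c - F') = rank (F_c² - F_c)`. -/
theorem stub_pairStability :
    ∃ C : ℕ, ∀ (K : Type) [Field K] (d : ℕ) (E F : Matrix (Fin d) (Fin d) K), E * E = E → F * F = F →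
      ∃ E' F' : Matrix (Fin d) (Fin d) K, E' * E' = E' ∧ F' * F' = F' ∧ E' * F' = F' * E' ∧
        (E - E').rank + (F - F').rank ≤ C * (E * F - F * E).rank := by
  exact Summit.PneNP.PneNP.Theorems.CnfIdealGenLengthRankDefectRepresentationsPairStability.stub_pairStability

/-! ### Bridging (definitional unfolding only) -/

theorem contradictoryPhantomsSpec_of_stub : ContradictoryPhantomsSpec := stub_contradictoryPhantoms

theorem theoryToCnfSpec_of_stub : TheoryToCnfSpec := stub_theoryToCnf

theorem diagonalSpec_of_stub : DiagonalSpec := stub_diagonal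

/-! ### Proved: the peeling lemma (`dim phantomKernel ≤ rank P_φ`, no commutation, no clause order) -/

/-- Membership in the phantom kernel, unfolded. -/
theorem mem_phantomKernel_iff {K : Type} [Field K] {n d : ℕ} (M : Fin n → Matrix (Fin d) (Fin d) K)
    (φ : CNF (Fin n)) (u : Fin d → K) :
    u ∈ phantomKernel M φ ↔ ∀ κ ∈ φ, (ev M (clauseWord K κ)).mulVec u = 0 := by
  simp [phantomKernel, Submodule.mem_iInf, LinearMap.mem_ker, Matrix.toLin'_apply]

/-- Peeling: if every clause word kills `u`, then `P_φ(M) u = u` (the factors `1 - Q_κ` are peeled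
right to left; neither commutation nor the clause order is used). -/
theorem clauseProduct_mulVec_of_forall {K : Type} [Field K] {n d : ℕ}
    (M : Fin n → Matrix (Fin d) (Fin d) K) (φ : CNF (Fin n)) (u : Fin d → K)
    (hu : ∀ κ ∈ φ, (ev M (clauseWord K κ)).mulVec u = 0) :
    (ev M (clauseProduct K φ)).mulVec u = u := by
  induction φ with
  | nil => simp [clauseProduct_nil]
  | cons κ φ ih =>
    have hκ : (ev M (clauseWord K κ)).mulVec u = 0 := hu κ (by simp)
    have ih' := ih (fun κ' hκ' => hu κ' (by simp [hκ']))
    simp only [ev] at ih' hκ ⊢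
    rw [clauseProduct_cons, map_mul, ← Matrix.mulVec_mulVec, ih', map_sub, map_one,
      Matrix.sub_mulVec, Matrix.one_mulVec, hκ, sub_zero]

/-- `P_φ(M)` is the identity on the phantom kernel. -/
theorem clauseProduct_mulVec_of_mem_phantomKernel {K : Type} [Field K] {n d : ℕ}
    (M : Fin n → Matrix (Fin d) (Fin d) K) (φ : CNF (Fin n)) (u : Fin d → K)
    (hu : u ∈ phantomKernel M φ) : (ev M (clauseProduct K φ)).mulVec u = u :=
  clauseProduct_mulVec_of_forall M φ u ((mem_phantomKernel_iff M φ u).1 hu)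

/-- Hence `dim phantomKernel(M, φ) ≤ rank P_φ(M)` for EVERY tuple `M`. -/
theorem finrank_phantomKernel_le_rank {K : Type} [Field K] {n d : ℕ}
    (M : Fin n → Matrix (Fin d) (Fin d) K) (φ : CNF (Fin n)) :
    Module.finrank K (phantomKernel M φ) ≤ (ev M (clauseProduct K φ)).rank := by
  unfold Matrix.rank
  apply Submodule.finrank_mono
  intro u hu
  refine ⟨u, ?_⟩
  rw [Matrix.mulVecLin_apply]
  exact clauseProduct_mulVec_of_mem_phantomKernel M φ u hu


/-! ### Composition (sorry-free): S1 → S2 → S3 → PNC, then PNC → the crux by peeling -/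

/-- The uniform size polynomial `(w+1)·(2X+2)^(w+1)` attached to width `w`. -/
noncomputable def widthPoly (w : ℕ) : Polynomial ℕ :=
  Polynomial.C (w + 1) * (Polynomial.C 2 * Polynomial.X + Polynomial.C 2) ^ (w + 1)

theorem eval_widthPoly (w n : ℕ) : (widthPoly w).eval n = (w + 1) * (2 * n + 2) ^ (w + 1) := by
  simp [widthPoly, Polynomial.eval_mul, Polynomial.eval_pow, Polynomial.eval_add]

/-- S1 ∧ S2 ∧ S3 ⇒ PNC. -/
theorem pnc_of_specs (h₁ : ContradictoryPhantomsSpec) (h₂ : TheoryToCnfSpec) (h₃ : DiagonalSpec) :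
    PhantomKernelRepresentations := by
  obtain ⟨w, hw⟩ := h₁
  refine h₃ (widthPoly w) fun c => ?_
  filter_upwards [hw c] with n hn
  obtain ⟨K, iK, iC, d, t, M, U, hM, hlt, hcon⟩ := hn
  obtain ⟨φ, hunsat, hnum, hsize, hU⟩ := h₂ n w K d M U hcon
  refine ⟨φ, ⟨hunsat, ?_, ?_⟩, K, iK, iC, d, t, M, hM, lt_of_lt_of_le hlt (Submodule.finrank_mono hU)⟩
  · rw [eval_widthPoly]
    calc CNF.numClauses φ ≤ (2 * n + 2) ^ (w + 1) := hnum
      _ = 1 * (2 * n + 2) ^ (w + 1) := (one_mul _).symm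
      _ ≤ (w + 1) * (2 * n + 2) ^ (w + 1) := Nat.mul_le_mul_right _ (Nat.succ_le_succ (Nat.zero_le w))
  · rw [eval_widthPoly]; exact hsize

/-! ### The skeleton theorem: the crux BY NAME from the registered stubs -/

/-- `RankDefectRepresentations` from S1 (`stub_contradictoryPhantoms`), S2 (`stub_theoryToCnf`),
S3 (`stub_diagonal`): PNC by `pnc_of_specs`, then `dim phantomKernel ≤ rank P_φ` (peeling). The only
`sorry`s of the file are the three stubs. -/
theorem RankDefectRepresentations_of : RankDefectRepresentations := by
  obtain ⟨p, φ, hφ, h⟩ :=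
    pnc_of_specs contradictoryPhantomsSpec_of_stub theoryToCnfSpec_of_stub diagonalSpec_of_stub
  refine ⟨p, φ, hφ, fun c => ?_⟩
  filter_upwards [h c] with n hn
  obtain ⟨K, _, _, d, t, M, hM, hlt⟩ := hn
  exact ⟨K, inferInstance, inferInstance, d, t, M, hM,
    lt_of_lt_of_le hlt (finrank_phantomKernel_le_rank M (φ n))⟩

end Summit.PneNP.PneNP.Cruxes.RankDefectRepresentations.PhantomKernel
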